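import Mathlib
import Literature.Combinatorics.Enumerative.EntringerNumbers
import Literature.Combinatorics.Enumerative.DerivativePolynomialGeneratingFunctions
import HarnessLib

/-!
# The boustrophedon transform (Millar–Sloane–Young 1996): Theorem 1 and the whole triangle

Topic `Combinatorics/Enumerative`, namespace `Literature.Combinatorics.Enumerative.Boustrophedon`.  Continues
`EntringerNumbers.lean` (the Seidel–Entringer–Arnold triangle `entringer n k = E_{n,k}` with its boustrophedon
rule `entringer_succ_succ` and `E_{n,n} = Eₙ`) and `EulerZigzagGeneratingFunction.lean` (`Σ Eₙxⁿ/n! = sec + tan`).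
Definitions: `triangle a n k = T_{n,k}` (MSY (5)), `transform a n = bₙ = T_{n,n}`, `skew a m k = T_{m+k,k}`,
`skewEntringer m k = E_{m+k,k}`, `conv` (the closed form); everything else PROVED; no named fact, no `sorry`,
no instance, no notation.

## Source, verbatim

J. Millar, N. J. A. Sloane, N. E. Young, *A new operation on sequences: the boustrophedon transform*, J. Combin.
Theory Ser. A 76 (1996) 44–54 [MillarSloaneYoung1996] (held: arXiv:math/0205218, «enhanced version»), §§1–3:

> (1) `E_{0,0} = 1, E_{n,0} = 0 (n ≥ 1), E_{n+1,k+1} = E_{n+1,k} + E_{n,n−k} (n ≥ k ≥ 0)`. […] «the entries are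
> filled in by the rule that each row (after the zero-th) begins with a 0 and every subsequent entry is the sum
> of the previous entry in the same row and the entry above it in the previous row.» […] (3) `𝓔(x) = Σ Eₙxⁿ/n! =
> sec x + tan x`. […] «Guy [Guy95] observed that if the entries at the beginnings of the rows in (2) are changed
> from 1,0,0,0,… to say 1,1,1,1,1,…, […] Using 1,1,1,… for example the triangle becomes (4)
> 1 / 1 2 / 4 3 1 / 1 5 8 9 / 24 23 18 10 1 / 1 25 48 66 76 77 / ⋯ yielding the sequence 1,2,4,9,24,77,294,1309,….»
> §2. «Given a sequence a = (a₀, a₁, a₂, …) we define its boustrophedon transform to be the sequence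
> b = (b₀, b₁, b₂, …) produced by the triangle (9) [a₀ = b₀; a₁ → b₁ = a₀ + a₁; b₂ = a₁ + a₂ + b₁ ← a₂ + b₁ ← a₂;
> a₃ → a₃ + b₂ → a₂ + a₃ + b₁ + b₂ → b₃ = 2a₂ + a₃ + b₁ + b₂; ⋯] […] Formally, the entries T_{n,k} (n ≥ k ≥ 0)
> in the triangle are defined by (5) T_{n,0} = a_n (n ≥ 0), T_{n+1,k+1} = T_{n+1,k} + T_{n,n−k} (n ≥ k ≥ 0), and
> then b_n = T_{n,n} (n ≥ 0).» [footnote: «In this paper we consider only integer-valued sequences, although the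
> transformation can be applied to sequences over any ring.»]
> «Theorem 1. The boustrophedon transform b of a sequence a is given by (6) b_n = Σ_{k=0}^{n} binom(n,k) a_k
> E_{n−k}, (n ≥ 0), (7) a_n = Σ_{k=0}^{n} (−1)^{n−k} binom(n,k) b_k E_{n−k}, (n ≥ 0), and the e.g.f.'s of b and a
> are related by (8) 𝓑(x) = (sec x + tan x) 𝓐(x).»  Proof via the path numbers π(n,k,i) of the graph Γ:
> (11) `T_{n,k} = Σ_{i=0}^{n} π(n,k,i) a_i`, (12) `E_n = π(n,n,0)`, «Proposition 2. π(n,n,k) = binom(n,k)E_{n−k},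
> for 0 ≤ k ≤ n.» «Proposition 3. For n ≥ 1, 0 ≤ k ≤ n−1, π(n,k,0) = E_{n,k} = Σ_r (−1)^r binom(k,2r+1)
> E_{n−2r−1}.» «Proposition 4. For n ≥ 2, 0 < k < n, 0 < i ≤ n, π(n,k,i) = Σ_s binom(k,s) binom(n−k,n−i−s)
> π(n−i,s,0).» «Propositions 1–4 together express all the boustrophedon numbers in terms of the E_n's, and via
> (11) give an explicit formula for every entry in the triangle (9).»
> §3 Example 1: (15) «has e.g.f. eˣ(sec x + tan x)»; Example 2: «The boustrophedon transform of the Bell numbers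
> […] produces the sequence 1, 2, 5, 16, 60, 258, …»; Example 3: «The boustrophedon transform of the E_n sequence
> shifted one place to the left is the same sequence shifted two places to the left […] this means the e.g.f.
> 𝓔(x) satisfies 𝓔(x)𝓔′(x) = 𝓔″(x).»; Example 4: «The sequence 1, 0, 1, 1, 2, 6, 17, 62, 259, 1230, … is the
> lexicographically earliest sequence that begins with 1 and shifts two places left under the boustrophedon
> transform.»

## What is formalized, and how (a different proof of the same statements)

MSY prove Theorem 1 by counting paths in Γ through «box diagrams».  We prove the stronger closed form for the
whole triangle ALGEBRAICALLY: in the skew coordinates `G(m,k) = T_{m+k,k}` the rule (5) reads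
`G(m,k+1) = G(m+1,k) + G(k,m)`, `G(m,0) = a_m` (`skew_succ`), which determines `G` (`skew_ext`); the Entringer
numbers `e(m,k) = E_{m+k,k}` satisfy the same rule with first column `1,0,0,…` (`skewEntringer_succ`); and the
candidate `C(m,k) = Σ_{i+j=m} Σ_{u+v=k} binom(m,i)binom(k,u) a_{i+u} e(j,v)` satisfies it too (`conv_succ`: Pascal's
rule in each variable — Mathlib's `Finset.sum_antidiagonal_choose_succ_mul` — and the Entringer rule once).  Hence:

* §1–§2 `triangle`, `transform`, the rule `triangle_succ_succ`, `b₀..b₃` as printed in (9), `skew_succ`, `skew_ext`.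
* §3 ★ the transform of `1,0,0,…` is the Entringer triangle / the Euler numbers (`triangle_delta_zero`,
  `transform_delta_zero`; (12) and the first part of Proposition 3).
* §4 ★★★ `skew_eq_conv` (all entries of the triangle: Propositions 2–4 with (11), in closed form), ★★★
  **Theorem 1 (6)** `transform_eq_sum : bₙ = Σ binom(n,k) aₖ E_{n−k}` over any commutative semiring, ★
  **Proposition 2** `transform_delta : T_{n,n}(δ_k) = binom(n,k)E_{n−k}`, linearity.
* §5 ★★★ **Theorem 1 (7)** `eq_sum_transform : aₙ = Σ (−1)^{n−k} binom(n,k) bₖ E_{n−k}` over any commutative ring,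
  through `Σ (−1)ᵏbinom(r,k)E_kE_{r−k} = [r = 0]` (= `(sec − tan)(sec + tan) = 1` coefficientwise).
* §6 ★★★ **Theorem 1 (8)** `transform_egf : 𝓑 = (sec + tan)·𝓐` in `ℚ⟦x⟧`, and `𝓐 = (sec − tan)·𝓑`.
* §7 ★ Examples 1–4: `1,1,1,… ↦ 1,2,4,9,24,77,294,1309` with the triangle (4) and the closed form `Σ binom(n,k)E_k`;
  Bell numbers `↦ 1,2,5,16,60,258` (with Mathlib's `Nat.bell 0..5 = 1,1,2,5,15,52`); `(E_{n+1}) ↦ (E_{n+2})`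
  (`𝓔𝓔′ = 𝓔″`, i.e. `Σ binom(n,k)E_{k+1}E_{n−k} = E_{n+2}`); Example 4 checked on its ten printed terms.

NOT typed here: the graph Γ, the path numbers `π(n,k,i)` as path counts and the box-diagram bijections
(Proposition 1's bijection, whose printed form needs Callan's 2002 correction), the explicit Entringer formula
`E_{n,k} = Σ_r (−1)^r binom(k,2r+1)E_{n−2r−1}` of Proposition 3 ([Ent66]), Example 5 / Theorem 2 (the double-ox
transform; a separate file), and the «lexicographically earliest» claim of Example 4 beyond the printed terms.
-/

namespace Literature.Combinatorics.Enumerative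
namespace Boustrophedon

open Finset
open scoped Nat PowerSeries

section Semiring

variable {R : Type*} [CommSemiring R]

/-! ### §1 The triangle (5) and the transform -/

/-- **The boustrophedon triangle of a sequence `a`** (MSY (5)): `T_{n,0} = aₙ` and
`T_{n+1,k+1} = T_{n+1,k} + T_{n,n−k}`; typed by the unrolled rule `T_{n+1,k} = a_{n+1} + Σ_{i<k} T_{n,n−i}`
(«each row (after the zero-th) begins with [aₙ] and every subsequent entry is the sum of the previous entry in
the same row and the entry above it in the previous row», the rows being read alternately right-to-left and
left-to-right).  Entries with `k > n` are not part of the triangle (junk values).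
[cite: MillarSloaneYoung1996, §2 eq. (5) («T_{n,0} = a_n (n ≥ 0), T_{n+1,k+1} = T_{n+1,k} + T_{n,n−k} (n ≥ k ≥ 0)»)] -/
def triangle (a : ℕ → R) : ℕ → ℕ → R
  | 0, _ => a 0
  | n + 1, k => a (n + 1) + ∑ i ∈ range k, triangle a n (n - i)

/-- **The boustrophedon transform** `b` of `a`: `bₙ = T_{n,n}`, the number at the end of row `n`.
[cite: MillarSloaneYoung1996, §2 («and then b_n = T_{n,n} (n ≥ 0)»)] -/
def transform (a : ℕ → R) (n : ℕ) : R := triangle a n n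

/-- `T_{n,0} = aₙ`. [cite: MillarSloaneYoung1996, §2 eq. (5) («T_{n,0} = a_n»)] -/
@[simp] theorem triangle_zero_right (a : ℕ → R) (n : ℕ) : triangle a n 0 = a n := by
  cases n <;> simp [triangle]

/-- The rule of the triangle: `T_{n+1,k+1} = T_{n+1,k} + T_{n,n−k}`.
[cite: MillarSloaneYoung1996, §2 eq. (5) («T_{n+1,k+1} = T_{n+1,k} + T_{n,n−k} (n ≥ k ≥ 0)»)] -/
theorem triangle_succ_succ (a : ℕ → R) (n k : ℕ) :
    triangle a (n + 1) (k + 1) = triangle a (n + 1) k + triangle a n (n - k) := by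
  rw [triangle, triangle, sum_range_succ, add_assoc]

/-- `b₀ = a₀`. [cite: MillarSloaneYoung1996, §2 (the triangle: «a₀ = b₀»)] -/
@[simp] theorem transform_zero (a : ℕ → R) : transform a 0 = a 0 := by
  simp [transform, triangle]

/-- `b₁ = a₀ + a₁`. [cite: MillarSloaneYoung1996, §2 (the triangle: «a₁ → b₁ = a₀ + a₁»)] -/
theorem transform_one (a : ℕ → R) : transform a 1 = a 0 + a 1 := by
  simp [transform, triangle, add_comm]

/-- `b₂ = a₁ + a₂ + b₁`. [cite: MillarSloaneYoung1996, §2 (the triangle: «b₂ = a₁ + a₂ + b₁ ← a₂ + b₁ ← a₂»)] -/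
theorem transform_two (a : ℕ → R) : transform a 2 = a 1 + a 2 + transform a 1 := by
  simp [transform, triangle, sum_range_succ]
  ring

/-- `b₃ = 2a₂ + a₃ + b₁ + b₂`. [cite: MillarSloaneYoung1996, §2 (the triangle: «b₃ = 2a₂ + a₃ + b₁ + b₂»)] -/
theorem transform_three (a : ℕ → R) :
    transform a 3 = 2 * a 2 + a 3 + transform a 1 + transform a 2 := by
  simp [transform, triangle, sum_range_succ]
  ring

/-! ### §2 Skew coordinates: `G(m,k) = T_{m+k,k}` and the recurrence `G(m,k+1) = G(m+1,k) + G(k,m)` -/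

/-- The triangle in the coordinates `(m, k) = (n − k, k)`: `G(m,k) = T_{m+k,k}`.
[cite: MillarSloaneYoung1996, §2 proof of Theorem 1 (the directed graph Γ on the nodes T_{n,k})] -/
def skew (a : ℕ → R) (m k : ℕ) : R := triangle a (m + k) k

/-- `G(m,0) = aₘ`. [cite: MillarSloaneYoung1996, §2 eq. (5)] -/
@[simp] theorem skew_zero (a : ℕ → R) (m : ℕ) : skew a m 0 = a m := by
  simp [skew]

/-- The rule in skew coordinates: `G(m,k+1) = G(m+1,k) + G(k,m)` — the exchange of the two arguments in the
last term is the boustrophedon (the change of reading direction from row to row).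
[cite: MillarSloaneYoung1996, §2 eq. (5)] -/
theorem skew_succ (a : ℕ → R) (m k : ℕ) : skew a m (k + 1) = skew a (m + 1) k + skew a k m := by
  simp only [skew]
  rw [show m + (k + 1) = (m + k) + 1 by ring, triangle_succ_succ, Nat.add_sub_cancel,
    show m + 1 + k = m + k + 1 by ring, add_comm k m]

/-- `bₙ = G(0,n)`. [cite: MillarSloaneYoung1996, §2 («b_n = T_{n,n}»)] -/
theorem transform_eq_skew (a : ℕ → R) (n : ℕ) : transform a n = skew a 0 n := by
  simp [transform, skew]

/-- Uniqueness: the skew rule and the first column `G(·,0)` determine the whole array (induction on the row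
`m + k`, then on `k`). [cite: MillarSloaneYoung1996, §2 («the entries T_{n,k} … are defined by (5)»)] -/
theorem skew_ext {G H : ℕ → ℕ → R} (h0 : ∀ m, G m 0 = H m 0)
    (hG : ∀ m k, G m (k + 1) = G (m + 1) k + G k m) (hH : ∀ m k, H m (k + 1) = H (m + 1) k + H k m) :
    ∀ m k, G m k = H m k := by
  suffices h : ∀ n m k, m + k = n → G m k = H m k from fun m k => h _ m k rfl
  intro n
  induction n using Nat.strong_induction_on with
  | _ n ih =>
    intro m k
    induction k generalizing m with
    | zero => intro _; exact h0 m
    | succ k ihk =>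
        intro hmk
        rw [hG, hH, ihk (m + 1) (by omega), ih (k + m) (by omega) k m rfl]

/-! ### §3 The Entringer numbers as the triangle of `1, 0, 0, …` and their skew recurrence -/

/-- The Entringer numbers in skew coordinates: `e(m,k) = E_{m+k,k}` (cast into `R`).
[cite: MillarSloaneYoung1996, §1 eq. (1) («E_{0,0} = 1, E_{n,0} = 0 (n ≥ 1), E_{n+1,k+1} = E_{n+1,k} + E_{n,n−k}»)] -/
def skewEntringer (m k : ℕ) : R := (entringer (m + k) k : R)

/-- `e(m,0) = [m = 0]`. [cite: MillarSloaneYoung1996, §1 eq. (1) («E_{0,0} = 1, E_{n,0} = 0 (n ≥ 1)»)] -/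
theorem skewEntringer_zero (m : ℕ) : (skewEntringer m 0 : R) = if m = 0 then 1 else 0 := by
  unfold skewEntringer
  cases m with
  | zero => simp [entringer_zero_zero]
  | succ m => simp [entringer_succ_zero]

/-- `e(m,k+1) = e(m+1,k) + e(k,m)` (the boustrophedon rule (1) for the Entringer numbers).
[cite: MillarSloaneYoung1996, §1 eq. (1) («E_{n+1,k+1} = E_{n+1,k} + E_{n,n−k} (n ≥ k ≥ 0)»)] -/
theorem skewEntringer_succ (m k : ℕ) :
    (skewEntringer m (k + 1) : R) = skewEntringer (m + 1) k + skewEntringer k m := by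
  unfold skewEntringer
  rw [show m + (k + 1) = (m + k) + 1 by ring, entringer_succ_succ (by omega), Nat.add_sub_cancel,
    show m + 1 + k = m + k + 1 by ring, add_comm k m, Nat.cast_add]

/-- `e(0,k) = E_k`: the ends of the rows of the Seidel–Entringer–Arnold triangle are the Euler numbers.
[cite: MillarSloaneYoung1996, §1 («The numbers E_n := E_{n,n} … give the total number of … down-up permutations»)] -/
theorem skewEntringer_zero_left (k : ℕ) : (skewEntringer 0 k : R) = eulerZigzag k := by
  unfold skewEntringer
  rw [zero_add, entringer_self]

/-- ★ **The boustrophedon transform of `1, 0, 0, 0, …` is the Seidel–Entringer–Arnold triangle**: `T_{n,k} = E_{n,k}`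
(Proposition 3, first part: `π(n,k,0) = E_{n,k}`), here in skew coordinates.
[cite: MillarSloaneYoung1996, §1 («the boustrophedon transform of the sequence 1, 0, 0, 0, … is E₀, E₁, E₂, E₃, …») and §2 Proposition 3 («π(n,k,0) = E_{n,k}»)] -/
theorem skew_delta_zero (m k : ℕ) :
    skew (fun i => if i = 0 then (1 : R) else 0) m k = skewEntringer m k :=
  skew_ext (fun m => by rw [skew_zero, skewEntringer_zero]) (skew_succ _) skewEntringer_succ m k

/-- `T_{n,k} = E_{n,k}` for the sequence `1, 0, 0, …` (`k ≤ n`). [cite: MillarSloaneYoung1996, §2 Proposition 3 («π(n,k,0) = E_{n,k}»)] -/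
theorem triangle_delta_zero {n k : ℕ} (hk : k ≤ n) :
    triangle (fun i => if i = 0 then (1 : R) else 0) n k = (entringer n k : R) := by
  have h := skew_delta_zero (R := R) (n - k) k
  rwa [skew, skewEntringer, Nat.sub_add_cancel hk] at h

/-- `Eₙ` is the transform of `1, 0, 0, …` (eq. (12): `Eₙ = π(n,n,0)`).
[cite: MillarSloaneYoung1996, §2 eq. (12) («E_n = π(n,n,0)»)] -/
theorem transform_delta_zero (n : ℕ) :
    transform (fun i => if i = 0 then (1 : R) else 0) n = (eulerZigzag n : R) := by
  rw [transform_eq_skew, skew_delta_zero, skewEntringer_zero_left]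

/-! ### §4 The explicit formula for the whole triangle (Propositions 2–4) -/

/-- The candidate closed form in skew coordinates:
`C(m,k) = Σ_{i+j=m} Σ_{u+v=k} binom(m,i) binom(k,u) a_{i+u} e(j,v)` — «the box diagram … the columns that
do not contain stars identify one of the binom(n,k) k-subsets … while the starred columns themselves form a box
diagram … that identifies a down-up permutation» (Propositions 2 and 4, all the boustrophedon numbers at once).
[cite: MillarSloaneYoung1996, §2 Proposition 4 and eq. (11) («T_{n,k} = Σ_i π(n,k,i) a_i»)] -/
def conv (a : ℕ → R) (m k : ℕ) : R :=
  ∑ ij ∈ antidiagonal m, ∑ uv ∈ antidiagonal k,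
    (m.choose ij.1 : R) * (k.choose uv.1 : R) * a (ij.1 + uv.1) * skewEntringer ij.2 uv.2

/-- `C(m,0) = aₘ`. [cite: MillarSloaneYoung1996, §2 Remark («π(n,0,i) = 0 for n ≥ 1, 0 ≤ i ≤ n−1, and π(n,0,n) = 1»)] -/
theorem conv_zero (a : ℕ → R) (m : ℕ) : conv a m 0 = a m := by
  rw [conv, Finset.sum_eq_single (m, 0)]
  · simp [skewEntringer_zero]
  · rintro ⟨i, j⟩ hij hne
    have hj : j ≠ 0 := fun h => by
      subst h; rw [HasAntidiagonal.mem_antidiagonal, add_zero] at hij; subst hij; exact hne rfl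
    simp [skewEntringer_zero, hj]
  · intro h; exact absurd (by simp) h

/-- `C` satisfies the skew rule `C(m,k+1) = C(m+1,k) + C(k,m)` — two Pascal splittings and one use of the
Entringer rule (1). [cite: MillarSloaneYoung1996, §2 Proposition 4 (sketch of proof)] -/
theorem conv_succ (a : ℕ → R) (m k : ℕ) : conv a m (k + 1) = conv a (m + 1) k + conv a k m := by
  -- Pascal in the second variable, then the Entringer rule
  have h1 : conv a m (k + 1) =
      (∑ ij ∈ antidiagonal m, ∑ uv ∈ antidiagonal k,
        (m.choose ij.1 : R) * (k.choose uv.1 : R) * a (ij.1 + uv.1) * skewEntringer (ij.2 + 1) uv.2) +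
      (∑ ij ∈ antidiagonal m, ∑ uv ∈ antidiagonal k,
        (m.choose ij.1 : R) * (k.choose uv.1 : R) * a (ij.1 + uv.1) * skewEntringer uv.2 ij.2) +
      ∑ ij ∈ antidiagonal m, ∑ uv ∈ antidiagonal k,
        (m.choose ij.1 : R) * (k.choose uv.1 : R) * a (ij.1 + uv.1 + 1) * skewEntringer ij.2 uv.2 := by
    rw [conv]
    simp only [← Finset.sum_add_distrib]
    refine sum_congr rfl fun ij _ => ?_
    have h := Finset.sum_antidiagonal_choose_succ_mul
      (fun u v => (m.choose ij.1 : R) * a (ij.1 + u) * skewEntringer ij.2 v) k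
    have hL : ∑ uv ∈ antidiagonal (k + 1), (m.choose ij.1 : R) * ((k + 1).choose uv.1 : R) *
        a (ij.1 + uv.1) * skewEntringer ij.2 uv.2 =
        ∑ uv ∈ antidiagonal (k + 1), ((k + 1).choose uv.1 : R) *
          ((m.choose ij.1 : R) * a (ij.1 + uv.1) * skewEntringer ij.2 uv.2) :=
      sum_congr rfl fun uv _ => by ring
    rw [hL, h]
    simp only [← Finset.sum_add_distrib]
    refine sum_congr rfl fun uv huv => ?_
    rw [HasAntidiagonal.mem_antidiagonal] at huv
    rw [skewEntringer_succ, Nat.choose_symm_of_eq_add huv.symm, ← add_assoc]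
    ring
  -- Pascal in the first variable
  have h2 : conv a (m + 1) k =
      (∑ ij ∈ antidiagonal m, ∑ uv ∈ antidiagonal k,
        (m.choose ij.1 : R) * (k.choose uv.1 : R) * a (ij.1 + uv.1) * skewEntringer (ij.2 + 1) uv.2) +
      ∑ ij ∈ antidiagonal m, ∑ uv ∈ antidiagonal k,
        (m.choose ij.1 : R) * (k.choose uv.1 : R) * a (ij.1 + uv.1 + 1) * skewEntringer ij.2 uv.2 := by
    rw [conv]
    have hL : ∑ ij ∈ antidiagonal (m + 1), ∑ uv ∈ antidiagonal k, ((m + 1).choose ij.1 : R) *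
        (k.choose uv.1 : R) * a (ij.1 + uv.1) * skewEntringer ij.2 uv.2 =
        ∑ ij ∈ antidiagonal (m + 1), ((m + 1).choose ij.1 : R) *
          ∑ uv ∈ antidiagonal k, (k.choose uv.1 : R) * a (ij.1 + uv.1) * skewEntringer ij.2 uv.2 :=
      sum_congr rfl fun ij _ => by rw [mul_sum]; exact sum_congr rfl fun uv _ => by ring
    rw [hL, Finset.sum_antidiagonal_choose_succ_mul
      (fun i j => ∑ uv ∈ antidiagonal k, (k.choose uv.1 : R) * a (i + uv.1) * skewEntringer j uv.2) m]
    congr 1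
    · refine sum_congr rfl fun ij _ => ?_
      rw [mul_sum]
      exact sum_congr rfl fun uv _ => by ring
    · refine sum_congr rfl fun ij hij => ?_
      rw [HasAntidiagonal.mem_antidiagonal] at hij
      rw [Nat.choose_symm_of_eq_add hij.symm, mul_sum]
      exact sum_congr rfl fun uv _ => by rw [add_right_comm]; ring
  -- the swapped term
  have h3 : conv a k m =
      ∑ ij ∈ antidiagonal m, ∑ uv ∈ antidiagonal k,
        (m.choose ij.1 : R) * (k.choose uv.1 : R) * a (ij.1 + uv.1) * skewEntringer uv.2 ij.2 := by
    rw [conv, sum_comm]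
    exact sum_congr rfl fun ij _ => sum_congr rfl fun uv _ => by rw [add_comm uv.1 ij.1]; ring
  rw [h1, h2, h3]
  ring

/-- ★★★ **All the boustrophedon numbers** (Propositions 2–4 together): in skew coordinates,
`T_{m+k,k} = Σ_{i+j=m} Σ_{u+v=k} binom(m,i) binom(k,u) a_{i+u} E_{j+v,v}` — equivalently (eq. (11) with
Proposition 4) `π(m+k, k, i+u)` is the sum of `binom(m,i)binom(k,u)E_{j+v,v}` over the splittings.
[cite: MillarSloaneYoung1996, §2 Propositions 2–4 («Propositions 1–4 together express all the boustrophedon numbers in terms of the E_n's, and via (11) give an explicit formula for every entry in the triangle (9)»)] -/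
theorem skew_eq_conv (a : ℕ → R) (m k : ℕ) : skew a m k = conv a m k :=
  skew_ext (fun m => by rw [skew_zero, conv_zero]) (skew_succ a) (conv_succ a) m k

/-- ★★★ **Theorem 1, (6)**: `bₙ = Σₖ binom(n,k) aₖ E_{n−k}` (over any commutative ring).
[cite: MillarSloaneYoung1996, §2 Theorem 1 eq. (6) («b_n = Σ_{k=0}^{n} binom(n,k) a_k E_{n−k}, (n ≥ 0)»)] -/
theorem transform_eq_sum (a : ℕ → R) (n : ℕ) :
    transform a n = ∑ k ∈ range (n + 1), (n.choose k : R) * a k * eulerZigzag (n - k) := by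
  rw [transform_eq_skew, skew_eq_conv, conv, Nat.antidiagonal_zero, sum_singleton,
    Nat.sum_antidiagonal_eq_sum_range_succ_mk]
  refine sum_congr rfl fun k _ => ?_
  simp [skewEntringer_zero_left]

/-- **Proposition 2**: `π(n,n,k) = binom(n,k)E_{n−k}` — the transform of the sequence with a single `1` in
position `k` is `binom(n,k)E_{n−k}` at `n`. [cite: MillarSloaneYoung1996, §2 Proposition 2 («π(n,n,k) = binom(n,k) E_{n−k}, for 0 ≤ k ≤ n»)] -/
theorem transform_delta (k n : ℕ) :
    transform (fun i => if i = k then (1 : R) else 0) n = if k ≤ n then (n.choose k : R) * eulerZigzag (n - k) else 0 := by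
  rw [transform_eq_sum]
  split_ifs with h
  · rw [sum_eq_single k (fun j _ hj => by simp [hj]) (fun hk => absurd (mem_range.2 (Nat.lt_succ_of_le h)) hk)]
    simp
  · exact sum_eq_zero fun j hj => by
      have : j ≠ k := fun hjk => h (hjk ▸ Nat.lt_succ_iff.1 (mem_range.1 hj))
      simp [this]

/-- The transform is additive … [cite: MillarSloaneYoung1996, §2 eq. (11) («T_{n,k} = Σ_{i=0}^{n} π(n,k,i) a_i»: linearity in a)] -/
theorem transform_add (a a' : ℕ → R) (n : ℕ) : transform (a + a') n = transform a n + transform a' n := by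
  simp only [transform_eq_sum, Pi.add_apply, ← sum_add_distrib]
  exact sum_congr rfl fun k _ => by ring

/-- … and homogeneous: `T(c·a) = c·T(a)`. [cite: MillarSloaneYoung1996, §2 eq. (11) (linearity in a)] -/
theorem transform_smul (c : R) (a : ℕ → R) (n : ℕ) : transform (fun i => c * a i) n = c * transform a n := by
  simp only [transform_eq_sum, mul_sum]
  exact sum_congr rfl fun k _ => by ring

end Semiring

section Ring

variable {R : Type*} [CommRing R]

/-! ### §5 Theorem 1, (7): the inverse transform -/

/-- `(sec x + tan x)(sec x − tan x) = 1`, coefficientwise: `Σₖ (−1)ᵏ binom(r,k) E_k E_{r−k} = [r = 0]` (in any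
commutative ring). [cite: MillarSloaneYoung1996, §2 Theorem 1 eq. (7)–(8) («a_n = Σ (−1)^{n−k} binom(n,k) b_k E_{n−k}» ⇐ 1/(sec x + tan x) = sec x − tan x)] -/
theorem alternating_sum_choose_mul_eulerZigzag (r : ℕ) :
    ∑ k ∈ range (r + 1), (-1 : R) ^ k * (r.choose k : R) * eulerZigzag k * eulerZigzag (r - k) =
      if r = 0 then 1 else 0 := by
  -- over ℚ through the exponential generating functions, then cast
  suffices h : ∑ k ∈ range (r + 1), (-1 : ℤ) ^ k * (r.choose k : ℤ) * eulerZigzag k * eulerZigzag (r - k) =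
      if r = 0 then 1 else 0 by
    have := congrArg (Int.cast : ℤ → R) h
    push_cast at this
    rw [this]
  have hprod : (PowerSeries.mk fun j => (-1 : ℚ) ^ j * eulerZigzag j / (j ! : ℚ)) * eulerZigzagSeries = 1 := by
    have hneg : (PowerSeries.mk fun j => (-1 : ℚ) ^ j * eulerZigzag j / (j ! : ℚ)) = secSeries - tanSeries := by
      ext j
      rw [PowerSeries.coeff_mk, map_sub, coeff_secSeries, coeff_tanSeries]
      split_ifs with hj
      · rw [hj.neg_one_pow]; ring
      · rw [(Nat.not_even_iff_odd.1 hj).neg_one_pow]; ring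
    rw [hneg, eulerZigzagSeries_eq]
    linear_combination secSeries_sq
  have hc := PowerSeries.ext_iff.1 hprod r
  rw [eulerZigzagSeries, show (PowerSeries.mk fun n => (eulerZigzag n : ℚ) / (n ! : ℚ)) =
      PowerSeries.mk fun n => ((eulerZigzag n : ℚ)) / (n ! : ℚ) from rfl] at hc
  rw [show (PowerSeries.mk fun j => (-1 : ℚ) ^ j * eulerZigzag j / (j ! : ℚ)) =
      PowerSeries.mk fun j => ((-1 : ℚ) ^ j * eulerZigzag j) / (j ! : ℚ) from rfl,
    DerivativePolynomials.coeff_egf_mul, PowerSeries.coeff_one] at hc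
  have hr : (r ! : ℚ) ≠ 0 := by positivity
  apply Int.cast_injective (α := ℚ)
  push_cast
  rw [div_eq_iff hr] at hc
  rw [show (∑ k ∈ range (r + 1), (-1 : ℚ) ^ k * (r.choose k : ℚ) * eulerZigzag k * eulerZigzag (r - k)) =
      ∑ j ∈ range (r + 1), (r.choose j : ℚ) * ((-1) ^ j * eulerZigzag j) * eulerZigzag (r - j) from
      sum_congr rfl fun j _ => by ring, hc]
  split_ifs with h0 <;> simp [h0]

/-- ★★★ **Theorem 1, (7)**: the inverse transform `aₙ = Σₖ (−1)^{n−k} binom(n,k) bₖ E_{n−k}` (any commutative ring).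
[cite: MillarSloaneYoung1996, §2 Theorem 1 eq. (7) («a_n = Σ_{k=0}^{n} (−1)^{n−k} binom(n,k) b_k E_{n−k}, (n ≥ 0)»)] -/
theorem eq_sum_transform (a : ℕ → R) (n : ℕ) :
    a n = ∑ k ∈ range (n + 1), (-1 : R) ^ (n - k) * (n.choose k : R) * transform a k * eulerZigzag (n - k) := by
  simp only [transform_eq_sum]
  -- Σ_k Σ_{j ≤ k}  ↦  Σ_j Σ_{k = j + l}
  have hswap : ∑ k ∈ range (n + 1), (-1 : R) ^ (n - k) * (n.choose k : R) *
      (∑ j ∈ range (k + 1), (k.choose j : R) * a j * eulerZigzag (k - j)) * eulerZigzag (n - k) =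
      ∑ j ∈ range (n + 1), (n.choose j : R) * a j *
        ∑ l ∈ range (n - j + 1), (-1 : R) ^ (n - j - l) * ((n - j).choose l : R) *
          eulerZigzag l * eulerZigzag (n - j - l) := by
    have h1 : ∑ k ∈ range (n + 1), (-1 : R) ^ (n - k) * (n.choose k : R) *
        (∑ j ∈ range (k + 1), (k.choose j : R) * a j * eulerZigzag (k - j)) * eulerZigzag (n - k) =
        ∑ k ∈ range (n + 1), ∑ j ∈ range (k + 1), (-1 : R) ^ (n - k) * (n.choose k : R) *
          ((k.choose j : R) * a j * eulerZigzag (k - j)) * eulerZigzag (n - k) :=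
      sum_congr rfl fun k _ => by rw [mul_sum, sum_mul]
    rw [h1, sum_comm' (t' := range (n + 1)) (s' := fun j => Ico j (n + 1))
      (fun k j => by simp only [mem_range, mem_Ico]; omega)]
    refine sum_congr rfl fun j hj => ?_
    have hjn : j ≤ n := Nat.lt_succ_iff.1 (mem_range.1 hj)
    rw [sum_Ico_eq_sum_range, show n + 1 - j = n - j + 1 by omega, mul_sum]
    refine sum_congr rfl fun l hl => ?_
    have hl' : l ≤ n - j := Nat.lt_succ_iff.1 (mem_range.1 hl)
    have hchoose : (n.choose (j + l) : R) * ((j + l).choose j : R) = (n.choose j : R) * ((n - j).choose l : R) := by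
      have := Nat.choose_mul (n := n) (k := j + l) (s := j) (by omega)
      rw [Nat.add_sub_cancel_left] at this
      have h' := congrArg (Nat.cast : ℕ → R) this
      push_cast at h'
      exact h'
    rw [show n - (j + l) = n - j - l by omega, Nat.add_sub_cancel_left]
    linear_combination ((-1 : R) ^ (n - j - l) * a j * eulerZigzag l * eulerZigzag (n - j - l)) * hchoose
  rw [hswap, sum_eq_single n]
  · have hE0 : eulerZigzag 0 = 1 := by decide
    rw [Nat.sub_self, zero_add, sum_range_one, Nat.choose_self, Nat.choose_zero_right, Nat.sub_zero,
      pow_zero, hE0]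
    simp
  · intro j hj hjn
    have hjn' : j < n := lt_of_le_of_ne (Nat.lt_succ_iff.1 (mem_range.1 hj)) hjn
    have h := alternating_sum_choose_mul_eulerZigzag (R := R) (n - j)
    rw [if_neg (by omega)] at h
    rw [← sum_range_reflect] at h
    have h' : ∑ l ∈ range (n - j + 1), (-1 : R) ^ (n - j - l) * ((n - j).choose l : R) *
        eulerZigzag l * eulerZigzag (n - j - l) = 0 := by
      rw [← h]
      refine sum_congr rfl fun l hl => ?_
      have hl' : l ≤ n - j := Nat.lt_succ_iff.1 (mem_range.1 hl)
      rw [show n - j + 1 - 1 - l = n - j - l by omega, Nat.choose_symm hl',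
        show n - j - (n - j - l) = l by omega]
      ring
    rw [h', mul_zero]
  · intro h; exact absurd (self_mem_range_succ n) h

end Ring

/-! ### §6 Theorem 1, (8): `𝓑(x) = (sec x + tan x)·𝓐(x)` -/

section EGF

variable {K : Type*} [Field K] [CharZero K]

/-- The derivative of an exponential generating function shifts the sequence: `(Σ fⱼ xʲ/j!)′ = Σ f_{j+1} xʲ/j!`.
[cite: MillarSloaneYoung1996, §3 Example 3 («𝓔(x)𝓔′(x) = 𝓔″(x)»)] -/
theorem derivative_egf (f : ℕ → K) :
    d⁄dX K (PowerSeries.mk fun j => f j / (j ! : K)) = PowerSeries.mk fun j => f (j + 1) / (j ! : K) := by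
  ext j
  rw [PowerSeries.coeff_derivative, PowerSeries.coeff_mk, PowerSeries.coeff_mk, Nat.factorial_succ,
    Nat.cast_mul, Nat.cast_succ]
  have h1 : (j ! : K) ≠ 0 := Nat.cast_ne_zero.2 (Nat.factorial_ne_zero _)
  have h2 : ((j : K) + 1) ≠ 0 := Nat.cast_add_one_ne_zero j
  field_simp

end EGF

/-- ★★★ **Theorem 1, (8)**: the exponential generating functions satisfy `𝓑(x) = (sec x + tan x)·𝓐(x)`
(`sec x + tan x = Σ Eₙxⁿ/n!` is the tree's `eulerZigzagSeries`, André's theorem `eulerZigzagSeries_eq`).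
[cite: MillarSloaneYoung1996, §2 Theorem 1 eq. (8) («𝓑(x) = (sec x + tan x) 𝓐(x)»)] -/
theorem transform_egf (a : ℕ → ℚ) :
    (PowerSeries.mk fun n => transform a n / (n ! : ℚ)) =
      eulerZigzagSeries * PowerSeries.mk fun n => a n / (n ! : ℚ) := by
  ext n
  rw [PowerSeries.coeff_mk, mul_comm, eulerZigzagSeries, DerivativePolynomials.coeff_egf_mul, transform_eq_sum]

/-- (8) with `sec x + tan x` spelled out: `𝓑 = (sec + tan)·𝓐` for the tree's `secSeries`, `tanSeries`.
[cite: MillarSloaneYoung1996, §2 Theorem 1 eq. (8)] -/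
theorem transform_egf' (a : ℕ → ℚ) :
    (PowerSeries.mk fun n => transform a n / (n ! : ℚ)) =
      (secSeries + tanSeries) * PowerSeries.mk fun n => a n / (n ! : ℚ) := by
  rw [transform_egf, eulerZigzagSeries_eq]

/-- The inverse relation of e.g.f.'s: `𝓐(x) = (sec x − tan x)·𝓑(x)` (`1/(sec x + tan x) = sec x − tan x`, which is
the source of the signs `(−1)^{n−k}` in (7)). [cite: MillarSloaneYoung1996, §2 Theorem 1 eq. (7)–(8)] -/
theorem egf_eq_mul_transform_egf (a : ℕ → ℚ) :
    (PowerSeries.mk fun n => a n / (n ! : ℚ)) =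
      (secSeries - tanSeries) * PowerSeries.mk fun n => transform a n / (n ! : ℚ) := by
  rw [transform_egf', ← mul_assoc, show (secSeries - tanSeries) * (secSeries + tanSeries) = 1 by
    linear_combination secSeries_sq, one_mul]

/-! ### §7 The examples of §3 -/

/-- ★ **Example 1**: the transform of `1, 1, 1, …` is `1, 2, 4, 9, 24, 77, 294, 1309, …` (A000667), «the number of
ways that we can form a down-up sequence of some length ℓ ≥ 0 from {1, …, n}».
[cite: MillarSloaneYoung1996, §1 eq. (4) and §3 Example 1 («1, 2, 4, 9, 24, 77, 294, 1309, …»)] -/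
theorem transform_one_seq :
    (List.range 8).map (transform fun _ => (1 : ℕ)) = [1, 2, 4, 9, 24, 77, 294, 1309] := by
  decide

/-- Example 1, closed form: the `n`-th term is `Σₖ binom(n,k) E_k` (e.g.f. `eˣ(sec x + tan x)`).
[cite: MillarSloaneYoung1996, §3 Example 1 («(15) has e.g.f. eˣ(sec x + tan x)»)] -/
theorem transform_one_seq_eq (n : ℕ) :
    transform (fun _ => (1 : ℕ)) n = ∑ k ∈ range (n + 1), n.choose k * eulerZigzag k := by
  rw [transform_eq_sum, ← sum_range_reflect]
  refine sum_congr rfl fun k hk => ?_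
  have hk' : k ≤ n := Nat.lt_succ_iff.1 (mem_range.1 hk)
  simp only [Nat.cast_id, mul_one]
  rw [show n + 1 - 1 - k = n - k by omega, Nat.choose_symm hk', show n - (n - k) = k by omega]

/-- The full triangle (4) for the input `1, 1, 1, …`: rows `1 / 1 2 / 4 3 1 / 1 5 8 9 / 24 23 18 10 1 /
1 25 48 66 76 77` (printed in boustrophedon order; here each row listed as `T_{n,0}, …, T_{n,n}`).
[cite: MillarSloaneYoung1996, §1 eq. (4)] -/
theorem triangle_one_seq :
    (List.range 3).map (triangle (fun _ => (1 : ℕ)) 2) = [1, 3, 4] ∧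
      (List.range 4).map (triangle (fun _ => (1 : ℕ)) 3) = [1, 5, 8, 9] ∧
      (List.range 5).map (triangle (fun _ => (1 : ℕ)) 4) = [1, 10, 18, 23, 24] ∧
      (List.range 6).map (triangle (fun _ => (1 : ℕ)) 5) = [1, 25, 48, 66, 76, 77] := by
  decide

/-- ★ **Example 2**: the transform of the Bell numbers `1, 1, 2, 5, 15, 52, …` (Mathlib's `Nat.bell`) is
`1, 2, 5, 16, 60, 258, …` (A000764). [cite: MillarSloaneYoung1996, §3 Example 2 («produces the sequence 1, 2, 5, 16, 60, 258, …»)] -/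
theorem transform_bell :
    (List.range 6).map (transform fun n => ([1, 1, 2, 5, 15, 52].getD n 0 : ℕ)) = [1, 2, 5, 16, 60, 258] ∧
      (List.range 6).map Nat.bell = [1, 1, 2, 5, 15, 52] := by
  refine ⟨by decide, ?_⟩
  simp [List.range_succ, Nat.bell_succ', Finset.Nat.antidiagonal_succ, Nat.choose]

/-- `Σₖ binom(n,k) E_{k+1} E_{n−k} = E_{n+2}` — the coefficient form of `𝓔𝓔′ = 𝓔″` for `𝓔 = sec + tan`.
[cite: MillarSloaneYoung1996, §3 Example 3 («this means the e.g.f. 𝓔(x) satisfies 𝓔(x)𝓔′(x) = 𝓔″(x)»)] -/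
theorem sum_choose_mul_eulerZigzag_succ (n : ℕ) :
    ∑ k ∈ range (n + 1), n.choose k * eulerZigzag (k + 1) * eulerZigzag (n - k) = eulerZigzag (n + 2) := by
  -- `𝓔′ = sec·𝓔`, hence `𝓔″ = 𝓔 𝓔′` in `ℚ⟦X⟧`
  have hE : d⁄dX ℚ eulerZigzagSeries = secSeries * eulerZigzagSeries := by
    rw [eulerZigzagSeries_eq, map_add, derivative_secSeries, derivative_tanSeries]
    linear_combination -secSeries_sq
  have hE2 : d⁄dX ℚ (d⁄dX ℚ eulerZigzagSeries) = eulerZigzagSeries * d⁄dX ℚ eulerZigzagSeries := by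
    rw [hE, Derivation.leibniz, derivative_secSeries, smul_eq_mul, smul_eq_mul, hE, eulerZigzagSeries_eq]
    ring
  have hc := PowerSeries.ext_iff.1 hE2 n
  rw [eulerZigzagSeries, derivative_egf, derivative_egf, PowerSeries.coeff_mk, mul_comm,
    DerivativePolynomials.coeff_egf_mul, eq_div_iff (by positivity : (n ! : ℚ) ≠ 0),
    div_mul_cancel₀ _ (by positivity : (n ! : ℚ) ≠ 0)] at hc
  exact_mod_cast hc.symm

/-- ★ **Example 3**: the transform of `E₁, E₂, E₃, …` (the Euler numbers shifted once) is `E₂, E₃, E₄, …`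
(shifted twice). [cite: MillarSloaneYoung1996, §3 Example 3 («The boustrophedon transform of the E_n sequence shifted one place to the left is the same sequence shifted two places to the left»)] -/
theorem transform_eulerZigzag_succ {R : Type*} [CommSemiring R] (n : ℕ) :
    transform (fun k => (eulerZigzag (k + 1) : R)) n = eulerZigzag (n + 2) := by
  rw [transform_eq_sum, ← sum_choose_mul_eulerZigzag_succ n]
  push_cast
  rfl

/-- ★ **Example 4** on its printed terms: `1, 0, 1, 1, 2, 6, 17, 62, 259, 1230` shifts two places left under the
transform (`b₀, …, b₇ = a₂, …, a₉`). [cite: MillarSloaneYoung1996, §3 Example 4 («The sequence 1, 0, 1, 1, 2, 6, 17, 62, 259, 1230, … is the lexicographically earliest sequence that begins with 1 and shifts two places left under the boustrophedon transform»)] -/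
theorem transform_example_four :
    (List.range 8).map (transform fun n => ([1, 0, 1, 1, 2, 6, 17, 62, 259, 1230].getD n 0 : ℕ)) =
      [1, 1, 2, 6, 17, 62, 259, 1230] := by
  decide

end Boustrophedon
end Literature.Combinatorics.Enumerative
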